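import Literature.Algebra.Homology.TateNakayama
import HarnessLib

/-!
# Torsion-freeness of the standard lattices `k[X]`, `k[G]`, `k[G]^{(ι)}`, `I_G`, and Tate–Nakayama
# for permutation modules: `Ĥⁿ(U, ℤ[X]) ≅ Ĥⁿ⁺²(U, C ⊗ ℤ[X])`, `Ĥⁿ(U, I_G) ≅ Ĥⁿ⁺²(U, C ⊗ I_G)`

Topic `Algebra/Homology`; namespace `Literature.Algebra.Homology`.  Two instances (torsion-freeness of
Mathlib's monoid-algebra type `R[M]` and of additive subgroups — both missing from Mathlib at the
pin, so that the hypothesis `[IsAddTorsionFree M.V]` of the tree's `TateNakayama` /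
`CohomologicallyTrivialTensor` is found automatically for `M = ℤ[X]`, `ℤ[G]`, `ℤ[G]^{(ι)}`, `I_G`)
and theorems; NO named fact, no `sorry`.  Written for Route A / step G5 of the Poitou–Tate programme
of crux `stmt-BirchSwinnertonDyer-19295` (cell `bsd-schneider-ideate`, seat door-c4 gen 12).

Source.  D. Harari, *Galois Cohomology and Class Field Theory* (2020), Thm. 3.14 (Tate–Nakayama,
"for each torsion-free `G`-module `D`") [held copy `book:harari2017-galois-cohomology-class-field-theory`,
chunk p0084]; the permutation modules `ℤ[G/H]` and the augmentation ideal `I_G` are the torsion-free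
modules to which it is applied in class field theory (Harari Prop. 16.7, proof: "We take `r = -2` and
`M = ℤ`"; Serre, *Local Fields* XI §3; Lang, *Topics in Cohomology of Groups* III §3: `I_G`).

## What is formalised

* `MonoidAlgebra.instIsAddTorsionFree'` : `IsAddTorsionFree R[M]` for `R` torsion-free (any type
  `M`; Mathlib's `R[M]` is a one-field structure over `M →₀ R`, which carries the instance);
  `AddSubgroupClass.instIsAddTorsionFree'` : additive subgroups (e.g. sub-lattices such as `I_G`,
  submodules, kernels) of a torsion-free group are torsion-free.
* Checks that the instances fire (private): `(Rep.ofMulAction ℤ G X).V`, `(Rep.leftRegular ℤ G).V`,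
  `(Rep.free ℤ G ι).V`; and `isAddTorsionFree_augIdeal` (`I_G`, Lang III §3).
* (`G` finite, `C` a class module over `ℤ` with fundamental class `[φ]`, `U ≤ G`, `n ∈ ℤ`)
  **`IsClassModule.nonempty_tateNakayamaIso_ofMulAction`** (`Ĥⁿ(U, ℤ[X]) ≅ Ĥⁿ⁺²(U, C ⊗ ℤ[X])` for
  any `G`-set `X`), **`IsClassModule.nonempty_tateNakayamaIso_augIdeal`**
  (`Ĥⁿ(U, I_G) ≅ Ĥⁿ⁺²(U, C ⊗ I_G)`), and `IsClassModule.isCohomologicallyTrivial_splittingModule_tensor_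
  ofMulAction` (`C' ⊗ ℤ[X]` cohomologically trivial).

## References
* D. Harari, *Galois Cohomology and Class Field Theory* (2020), Thm. 3.14, Prop. 16.6, 16.7.
  [Harari2020]
* S. Lang, *Topics in Cohomology of Groups*, LNM 1625 (1996), III §3. [Lang1996]
-/

noncomputable section

open CategoryTheory MonoidalCategory

namespace Literature.Algebra.Homology

/-! ## §1 Torsion-freeness instances -/

/-- **`R[M]` is torsion-free if `R` is** (its coefficient map `R[M] ≃+ (M →₀ R)` is additive and
injective, and `M →₀ R` is torsion-free). [folklore] -/
instance MonoidAlgebra.instIsAddTorsionFree' {R M : Type*} [Semiring R] [IsAddTorsionFree R] :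
    IsAddTorsionFree (MonoidAlgebra R M) :=
  ⟨fun n hn x y hxy => by
    apply MonoidAlgebra.coeff_injective
    refine nsmul_right_injective hn ?_
    have h := congrArg (MonoidAlgebra.coeffAddEquiv (R := R) (M := M)) hxy
    simp only [map_nsmul] at h
    exact h⟩

/-- **Additive subgroups of torsion-free groups are torsion-free** (for any `AddSubgroupClass`, e.g.
submodules such as the augmentation ideal `I_G ⊆ k[G]`). [folklore] -/
instance AddSubgroupClass.instIsAddTorsionFree' {A S : Type*} [AddGroup A] [IsAddTorsionFree A]
    [SetLike S A] [AddSubgroupClass S A] (s : S) : IsAddTorsionFree s :=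
  ⟨fun n hn x y hxy => by
    apply Subtype.ext
    refine nsmul_right_injective hn ?_
    have h := congrArg (Subtype.val : s → A) hxy
    simpa only [AddSubmonoidClass.coe_nsmul] using h⟩

section Checks

variable (G : Type) [Group G] (X : Type) [MulAction G X] (ι : Type)

/-- `ℤ[X]` (the permutation module of a `G`-set) is torsion-free — a check that the instance fires
on the `Rep` carrier. [folklore] -/
private theorem isAddTorsionFree_ofMulAction : IsAddTorsionFree (Rep.ofMulAction ℤ G X).V :=
  inferInstance

/-- `ℤ[G]` is torsion-free (check). [folklore] -/
private theorem isAddTorsionFree_leftRegular : IsAddTorsionFree (Rep.leftRegular ℤ G).V :=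
  inferInstance

/-- `ℤ[G]^{(ι)}` is torsion-free (check). [folklore] -/
private theorem isAddTorsionFree_free : IsAddTorsionFree (Rep.free ℤ G ι).V :=
  inferInstance

/-- The augmentation ideal `I_G ⊆ ℤ[G]` is torsion-free. [cite: Lang1996, III §3] -/
theorem isAddTorsionFree_augIdeal : IsAddTorsionFree (SplittingModule.augIdeal ℤ G).V :=
  inferInstance

end Checks

/-! ## §2 Tate–Nakayama for permutation modules and for `I_G` -/

section TateNakayama

variable {G : Type} [Group G] [Fintype G] {C : Rep.{0} ℤ G} {φ : groupCohomology.cocycles₂ C}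

/-- **`Ĥⁿ(U, ℤ[X]) ≅ Ĥⁿ⁺²(U, C ⊗ ℤ[X])`** for a class module `C`, any `G`-set `X`, every subgroup `U`
and every `n ∈ ℤ` (Tate–Nakayama for the permutation lattice `ℤ[X]`).
[cite: Harari2020, Thm. 3.14, Prop. 16.6] -/
theorem IsClassModule.nonempty_tateNakayamaIso_ofMulAction (hC : IsClassModule C φ) (X : Type)
    [MulAction G X] (U : Subgroup G) [Fintype U] (n : ℤ) :
    Nonempty (tateCohomology (Rep.res U.subtype (Rep.ofMulAction ℤ G X)) n ≅
      tateCohomology (Rep.res U.subtype (C ⊗ Rep.ofMulAction ℤ G X)) (n + 2)) :=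
  hC.nonempty_tateNakayamaIso (Rep.ofMulAction ℤ G X) U n

/-- **`Ĥⁿ(U, I_G) ≅ Ĥⁿ⁺²(U, C ⊗ I_G)`** for a class module `C`, every subgroup `U` and every `n ∈ ℤ`
(Tate–Nakayama for the augmentation ideal). [cite: Harari2020, Thm. 3.14][cite: Lang1996, III §3] -/
theorem IsClassModule.nonempty_tateNakayamaIso_augIdeal (hC : IsClassModule C φ) (U : Subgroup G)
    [Fintype U] (n : ℤ) :
    Nonempty (tateCohomology (Rep.res U.subtype (SplittingModule.augIdeal ℤ G)) n ≅
      tateCohomology (Rep.res U.subtype (C ⊗ SplittingModule.augIdeal ℤ G)) (n + 2)) :=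
  hC.nonempty_tateNakayamaIso (SplittingModule.augIdeal ℤ G) U n

/-- **`C' ⊗ ℤ[X]` is cohomologically trivial** for the splitting module `C'` of a class module `C` and
any `G`-set `X` (Harari Lemma 3.10 with `D = ℤ[X]`). [cite: Harari2020, Lemma 3.10] -/
theorem IsClassModule.isCohomologicallyTrivial_splittingModule_tensor_ofMulAction
    (hC : IsClassModule C φ) (X : Type) [MulAction G X] :
    IsCohomologicallyTrivial (SplittingModule.splittingModule C φ ⊗ Rep.ofMulAction ℤ G X) :=
  hC.isCohomologicallyTrivial_splittingModule.tensor (Rep.ofMulAction ℤ G X)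

end TateNakayama

end Literature.Algebra.Homology
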